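import Summits.KontsevichZagierPeriods.KontsevichZagierPeriods.Theorems.VietaFibreKernelFormItemDictionary
import Summits.KontsevichZagierPeriods.KontsevichZagierPeriods.Theorems.VietaFibreKernelFormIsSummit
import HarnessLib

/-!
# Crux `KernelForm` (stmt-KontsevichZagierPeriods-10447) — line `Sketch` (idea localise-at-the-value-prime)

Skeleton of the line lead, RESHAPED by lead c23 (2026-08-17) to the crux-strategist's `[π]`-SPLIT
(`Cruxes/KernelForm/SPLIT-READY.md`, 2026-08-17T07:04Z): the two open stubs are, BY NAME, route
VietaFibre's OWN child declarations (rev 9), i.e. two EXISTING shared ledger items: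

* `stub_ayoubPiLocalKernel  : Theses.VietaFibre.AyoubPiLocalKernel`  = item stmt-KontsevichZagierPeriods-0541
  (transcendence half of Conjecture 1: evaluation is injective on `FormalRep ⧸ relations` localised at
  `[π]`; Kontsevich–Zagier 2001 §4.1 `P̂ = P[(2πi)⁻¹]`, Ayoub 2014 Def. 6 / Conj. 7; GPC-strength by the
  barrier catalogue `kzConjecture_implies_oddZetaAlgIndep` & co.);
* `stub_ayoubPiCancellation : Theses.VietaFibre.AyoubPiCancellation` = item stmt-KontsevichZagierPeriods-0540
  (`[π]` is a non-zero-divisor of `FormalRep ⧸ relations`; transcendence-free; motivic shadow open,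
  Huber–Wüstholz 2022 App. A.3–A.4; registered line `Cruxes/AyoubPiCancellation/Lines/Sketch.lean`).

Compared with the c12 skeleton (sha 9395b30c…, stubs 0541 and stmt-5621 `SelbergAMGM.PositiveCancellation`),
the second stub is STRICTLY WEAKER (`PositiveCancellation ≡ Cancellation ⇒ PiCancellation`,
`ayoubPiCancellation_of_positiveCancellation`) and is now an item of this very route; the cut is still
EXACT (`stubs_of_kernelForm`). The composition is ONE application of the landed item dictionary
`kernelForm_iff_ayoubPiLocalKernel_and_ayoubPiCancellation` (Theorems/VietaFibreKernelFormItemDictionary.lean,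
p121847: item 0541 as filed is `KZ.PiLocalKernel`, item 0540 is `KZ.PiCancellation`, which peels the
`N` factors `[π]` one at a time). Nothing stub-sized remains: both open stubs are conjecture-grade
halves of Kontsevich–Zagier's Conjecture 1 for this calculus, and the crux itself is verbatim
`KZKernelConjecture` = the summit (`kernelForm_iff_summit`, p125241).
-/

noncomputable section

open Literature.NumberTheory.Transcendental

namespace Summit.KontsevichZagierPeriods.KernelForm.LocaliseAtValuePrime

/-! ### Registered stubs (each is, by name, a child item of route VietaFibre) -/

/-- STUB = item stmt-KontsevichZagierPeriods-0541 verbatim (route VietaFibre's child `AyoubPiLocalKernel`,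
byte-identical with `AyoubSpecialisation.AyoubPiLocalKernel`; the closed-term `π`-local kernel
`KZ.PiLocalKernel` by `ayoubPiLocalKernel_iff_piLocalKernel`): conjecture-grade, GPC-strength
(transcendence half of Conjecture 1). Not worker-sized; closes when 0541 closes. -/
theorem stub_ayoubPiLocalKernel :
    Summit.KontsevichZagierPeriods.KontsevichZagierPeriods.Theses.VietaFibre.AyoubPiLocalKernel := by
  sorry

/-- STUB = item stmt-KontsevichZagierPeriods-0540 verbatim (route VietaFibre's child `AyoubPiCancellation`,
byte-identical with `AyoubSpecialisation.AyoubPiCancellation` `≡ KZ.PiCancellation` by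
`BetaCancellationLine.stub_ayoubBridge`): `[π]` is a non-zero-divisor modulo relations. Conjecture-grade
(motivic shadow open, Huber–Wüstholz 2022 App. A.4) but transcendence-free and WEAKER than the former
stub stmt-5621 (`ayoubPiCancellation_of_positiveCancellation`). Not worker-sized; closes when 0540 closes. -/
theorem stub_ayoubPiCancellation :
    Summit.KontsevichZagierPeriods.KontsevichZagierPeriods.Theses.VietaFibre.AyoubPiCancellation := by
  sorry

/-! ### The stubs under route AyoubSpecialisation's (definitionally equal) names -/

/-- Item 0541 under its AyoubSpecialisation name (same term). [folklore] -/
theorem ayoubSpecialisation_ayoubPiLocalKernel_of_stub :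
    Summit.KontsevichZagierPeriods.KontsevichZagierPeriods.Theses.AyoubSpecialisation.AyoubPiLocalKernel :=
  stub_ayoubPiLocalKernel

/-- Item 0540 under its AyoubSpecialisation name (same term). [folklore] -/
theorem ayoubSpecialisation_ayoubPiCancellation_of_stub :
    Summit.KontsevichZagierPeriods.KontsevichZagierPeriods.Theses.AyoubSpecialisation.AyoubPiCancellation :=
  stub_ayoubPiCancellation

/-! ### Composition -/

/-- **Composition**: the crux from the registered stubs — one application of the item dictionary
`kernelForm_iff_ayoubPiLocalKernel_and_ayoubPiCancellation` (p121847): 0541 gives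
`(lift (of ∘ P))^[N] c ∈ relations` for every `c` of value `0`, 0540 peels the `N` factors. -/
theorem KernelForm_of :
    Summit.KontsevichZagierPeriods.KontsevichZagierPeriods.Theses.VietaFibre.KernelForm :=
  kernelForm_iff_ayoubPiLocalKernel_and_ayoubPiCancellation.mpr
    ⟨ayoubSpecialisation_ayoubPiLocalKernel_of_stub, ayoubSpecialisation_ayoubPiCancellation_of_stub⟩

/-- Route OctahedralSymmetry's (definitionally equal) name of the shared crux. -/
theorem octahedralSymmetry_KernelForm_of :
    Summit.KontsevichZagierPeriods.KontsevichZagierPeriods.Theses.OctahedralSymmetry.KernelForm :=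
  KernelForm_of

/-- CONVERSELY the crux implies both stubs (each stub is necessary; the reshape loses nothing:
the `[π]`-split is exact). -/
theorem stubs_of_kernelForm
    (hK : Summit.KontsevichZagierPeriods.KontsevichZagierPeriods.Theses.VietaFibre.KernelForm) :
    Summit.KontsevichZagierPeriods.KontsevichZagierPeriods.Theses.VietaFibre.AyoubPiLocalKernel ∧
      Summit.KontsevichZagierPeriods.KontsevichZagierPeriods.Theses.VietaFibre.AyoubPiCancellation :=
  kernelForm_iff_ayoubPiLocalKernel_and_ayoubPiCancellation.mp hK

/-- Sanity: the former second stub (stmt-5621 `PositiveCancellation`) implies the new one, so the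
reshaped skeleton leans on strictly less. -/
example (h : Summit.KontsevichZagierPeriods.KontsevichZagierPeriods.Theses.SelbergAMGM.PositiveCancellation) :
    Summit.KontsevichZagierPeriods.KontsevichZagierPeriods.Theses.VietaFibre.AyoubPiCancellation :=
  ayoubPiCancellation_of_positiveCancellation h

end Summit.KontsevichZagierPeriods.KernelForm.LocaliseAtValuePrime
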